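import Summits.Ventures.HodgeRepro2.Defs
import Summits.Ventures.HodgeRepro2.Dictionary
import Summits.Ventures.HodgeRepro2.Levels

/-! # HodgeRepro2 — the rank-four face as a parity tetrahedron; the instantiated hypothesis; Picard forms

Blind re-derivation cell `pub-hodge-repro2`, seat p1 (fourth definitions file).  Sources as in `Defs.lean` /
`Dictionary.lean`: [Sh79] Shimura, J. Math. Soc. Japan 31 (1979), §4 and Thm 8.1 (p. 588); [De82] Deligne,
LNM 900, Ch. I Prop. 4.4; [DR15] Dimitrov–Ramakrishnan, Doc. Math. 20 (2015), p. 1.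

Contents: §10 the parity tetrahedron `{111, 100, 010, 001}` of CM types attached to a CM type `{τ_1, τ_2, τ_3}`
of a sextic CM field, PROVED to be a rank-four face in the sense of `IsWeilFace` (each embedding in exactly two
of the four types — [De82] Prop. 4.4 with `d = 4`); §11 the non-vanishing input instantiated on a face
(`FaceInstance`), which is the specialisation `r = 2` of [Sh79] Thm 8.1 to data whose CM type is a vertex of the
face; §12 explicit Picard forms `T = δ · diag(1, 1, a)` with `δ` purely imaginary and `a ∈ K⁺` of prescribed
signs, PROVED to satisfy every hypothesis of Thm 8.1 (skew-hermitian, signature `(2,1)` at `τ_1`, positive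
definite at the other two members of `Φ_δ`), so that `Thm81Data K 2` is inhabited once such an `a` is given;
§13 the reflex field `τ_1(K)` of a datum, and the irregularity bound `q(Γ'\D_r) ≥ r` that Theorem 8.1's
conclusion gives (`r` linearly independent invariant holomorphic 1-forms).  §10 also records the other balanced
4-sets, the double conjugate pairs `{Φ, Φ̄, Φ', Φ̄'}` (`conjugatePairFace`, proved to be faces). -/

namespace Summit.Ventures.HodgeRepro2

open Matrix NumberField
open scoped ComplexOrder

/-! ## 10. The parity tetrahedron of CM types -/

section Tetrahedron

variable (K : Type*) [Field K] [NumberField K]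

/-- The parity tetrahedron of a CM type `Φ₀ = {τ 0, τ 1, τ 2}` of a sextic CM field (`g = 3`).  In cube
coordinates (`ε_ν = 1` iff `τ ν ∈ T`, `ε_ν = 0` iff `τ̄ ν ∈ T`) its vertices are `T 0 = 111 = Φ₀`,
`T 1 = 100 = {τ 0, τ̄ 1, τ̄ 2}`, `T 2 = 010 = {τ̄ 0, τ 1, τ̄ 2}`, `T 3 = 001 = {τ̄ 0, τ̄ 1, τ 2}`: the `ν`-th
coordinate of vertex `i` is `1` iff `i = 0 ∨ i = ν + 1`.  Every embedding lies in exactly two of them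
(`isWeilFace_parityTetrahedron`); no two of them are complex conjugate. -/
def parityTetrahedron (τ : Fin 3 → (K →+* ℂ)) (i : Fin 4) : Set (K →+* ℂ) :=
  Set.range fun ν : Fin 3 =>
    if (i = 0 ∨ (i : ℕ) = (ν : ℕ) + 1) then τ ν else ComplexEmbedding.conjugate (τ ν)

omit [NumberField K] in
/-- The parity tetrahedron of a CM type `{τ 0, τ 1, τ 2}` (`τ` injective, its range a CM type) is a rank-four
face: its four members are CM types and every embedding lies in exactly two of them. -/
theorem isWeilFace_parityTetrahedron (τ : Fin 3 → (K →+* ℂ)) (hinj : Function.Injective τ)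
    (hΦ : IsCMType K (Set.range τ)) : IsWeilFace K (parityTetrahedron K τ) := by
  have cc : ∀ φ : K →+* ℂ, ComplexEmbedding.conjugate (ComplexEmbedding.conjugate φ) = φ :=
    fun φ => star_star φ
  have hconj_ne : ∀ ν μ, ComplexEmbedding.conjugate (τ ν) ≠ τ μ := by
    intro ν μ h
    rcases hΦ (τ μ) with ⟨_, h2⟩ | ⟨_, h2⟩
    · apply h2
      rw [← h, cc]
      exact ⟨ν, rfl⟩
    · exact h2 ⟨μ, rfl⟩
  have memA : ∀ (i : Fin 4) (ν : Fin 3),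
      τ ν ∈ parityTetrahedron K τ i ↔ (i = 0 ∨ (i : ℕ) = (ν : ℕ) + 1) := by
    intro i ν
    constructor
    · rintro ⟨μ, hμ⟩
      dsimp only at hμ
      by_cases hc : (i = 0 ∨ (i : ℕ) = (μ : ℕ) + 1)
      · rw [if_pos hc] at hμ
        have := hinj hμ
        subst this
        exact hc
      · rw [if_neg hc] at hμ
        exact absurd hμ (hconj_ne μ ν)
    · intro hc
      exact ⟨ν, if_pos hc⟩
  have memB : ∀ (i : Fin 4) (ν : Fin 3),
      ComplexEmbedding.conjugate (τ ν) ∈ parityTetrahedron K τ i ↔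
        ¬ (i = 0 ∨ (i : ℕ) = (ν : ℕ) + 1) := by
    intro i ν
    constructor
    · rintro ⟨μ, hμ⟩
      dsimp only at hμ
      by_cases hc : (i = 0 ∨ (i : ℕ) = (μ : ℕ) + 1)
      · rw [if_pos hc] at hμ
        exact absurd hμ.symm (hconj_ne ν μ)
      · rw [if_neg hc] at hμ
        have := hinj (star_injective hμ)
        subst this
        exact hc
    · intro hc
      exact ⟨ν, if_neg hc⟩
  have hcases : ∀ φ : K →+* ℂ, (∃ ν, φ = τ ν) ∨ (∃ ν, φ = ComplexEmbedding.conjugate (τ ν)) := by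
    intro φ
    rcases hΦ φ with ⟨⟨ν, hν⟩, _⟩ | ⟨⟨ν, hν⟩, _⟩
    · exact Or.inl ⟨ν, hν.symm⟩
    · right
      refine ⟨ν, ?_⟩
      rw [hν, cc]
  refine ⟨?_, ?_⟩
  · intro i φ
    rcases hcases φ with ⟨ν, rfl⟩ | ⟨ν, rfl⟩
    · rw [memA, memB]
      by_cases hc : (i = 0 ∨ (i : ℕ) = (ν : ℕ) + 1)
      · exact Or.inl ⟨hc, not_not.2 hc⟩
      · exact Or.inr ⟨hc, hc⟩
    · rw [memB, cc, memA]
      by_cases hc : (i = 0 ∨ (i : ℕ) = (ν : ℕ) + 1)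
      · exact Or.inr ⟨hc, not_not.2 hc⟩
      · exact Or.inl ⟨hc, hc⟩
  · intro φ
    rcases hcases φ with ⟨ν, rfl⟩ | ⟨ν, rfl⟩
    · rw [Nat.card_congr (Equiv.subtypeEquivRight (fun i => memA i ν)), Nat.card_eq_fintype_card]
      fin_cases ν <;> decide
    · rw [Nat.card_congr (Equiv.subtypeEquivRight (fun i => memB i ν)), Nat.card_eq_fintype_card]
      fin_cases ν <;> decide

omit [NumberField K] in
/-- The conjugate of a CM type is a CM type. -/
theorem isCMType_conjCMType {Φ : Set (K →+* ℂ)} (h : IsCMType K Φ) : IsCMType K (conjCMType K Φ) := by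
  intro φ
  have := h φ
  simp only [conjCMType, Set.mem_setOf_eq, ComplexEmbedding.conjugate, star_star]
  exact this.symm

/-- A predicate on `Fin 4` holding on exactly one member of each of the pairs `{0,1}`, `{2,3}` holds on
exactly two indices. -/
theorem nat_card_eq_two_of_xor_pairs (p : Fin 4 → Prop) (h01 : Xor (p 0) (p 1)) (h23 : Xor (p 2) (p 3)) :
    Nat.card {i // p i} = 2 := by
  classical
  rcases h01 with ⟨h0, h1⟩ | ⟨h1, h0⟩ <;> rcases h23 with ⟨h2, h3⟩ | ⟨h3, h2⟩
  · rw [Nat.card_congr (Equiv.subtypeEquivRight (q := fun i : Fin 4 => i = 0 ∨ i = 2) ?_),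
      Nat.card_eq_fintype_card]
    · decide
    · intro i; fin_cases i <;> simp [h0, h1, h2, h3]
  · rw [Nat.card_congr (Equiv.subtypeEquivRight (q := fun i : Fin 4 => i = 0 ∨ i = 3) ?_),
      Nat.card_eq_fintype_card]
    · decide
    · intro i; fin_cases i <;> simp [h0, h1, h2, h3]
  · rw [Nat.card_congr (Equiv.subtypeEquivRight (q := fun i : Fin 4 => i = 1 ∨ i = 2) ?_),
      Nat.card_eq_fintype_card]
    · decide
    · intro i; fin_cases i <;> simp [h0, h1, h2, h3]
  · rw [Nat.card_congr (Equiv.subtypeEquivRight (q := fun i : Fin 4 => i = 1 ∨ i = 3) ?_),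
      Nat.card_eq_fintype_card]
    · decide
    · intro i; fin_cases i <;> simp [h0, h1, h2, h3]

/-- The other kind of balanced 4-set (lead's reading of [De82] Prop. 4.4): two conjugate pairs
`{Φ, Φ̄, Φ', Φ̄'}`, whose corner product is `A_Φ × A_Φ̄ × A_Φ' × A_Φ̄'`. -/
def conjugatePairFace (Φ Φ' : Set (K →+* ℂ)) : Fin 4 → Set (K →+* ℂ) :=
  ![Φ, conjCMType K Φ, Φ', conjCMType K Φ']

omit [NumberField K] in
/-- Two conjugate pairs of CM types form a rank-four face. -/
theorem isWeilFace_conjugatePairFace {Φ Φ' : Set (K →+* ℂ)} (h : IsCMType K Φ) (h' : IsCMType K Φ') :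
    IsWeilFace K (conjugatePairFace K Φ Φ') := by
  refine ⟨fun i => ?_, fun φ => nat_card_eq_two_of_xor_pairs _ (h φ) (h' φ)⟩
  fin_cases i
  · exact h
  · exact isCMType_conjCMType K h
  · exact h'
  · exact isCMType_conjCMType K h'

end Tetrahedron

/-! ## 11. The non-vanishing input instantiated on a face -/

section FaceInstance

variable (K : Type*) [Field K] [NumberField K] [IsCMField K]

/-- The non-vanishing input of the transfer, instantiated on a rank-four face `T` of CM types of `K`: `T` is a
face, and for each vertex `T i` every [Sh79] Theorem 8.1 datum with `m = 3` (`r = 2`, the compact Picard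
modular surface when `[K:Q] > 2`) whose CM type `{τ_1, τ_2, τ_3}` is `T i` — distinguished embedding `τ_1 ∈ T i`,
`-i T^{τ_1}` of signature `(2,1)`, `-i T^{τ_ν} > 0` for `ν = 2, 3`, any full lattice — has the conclusion of
Theorem 8.1 (two `Γ'`-invariant closed holomorphic 1-forms `ξ_1, ξ_2` on the 2-ball with `ξ_1 ∧ ξ_2 ≠ 0`). -/
def FaceInstance (T : Fin 4 → Set (K →+* ℂ)) : Prop :=
  IsWeilFace K T ∧ ∀ (i : Fin 4) (D : Thm81Data K 2), D.Φ = T i → Thm81Conclusion D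

/-- The printed theorem ([Sh79] Thm 8.1 with `m = 3`) instantiates verbatim to every face. -/
theorem faceInstance_of_shimuraThm81 (T : Fin 4 → Set (K →+* ℂ)) (hT : IsWeilFace K T)
    (h : ShimuraThm81 K 2) : FaceInstance K T :=
  ⟨hT, fun _ D _ => h D⟩

/-- Conversely, the face instance is all that Theorem 8.1 contributes for CM types on the face. -/
theorem faceInstance_iff (T : Fin 4 → Set (K →+* ℂ)) (hT : IsWeilFace K T) :
    FaceInstance K T ↔ ∀ D : Thm81Data K 2, (∃ i, D.Φ = T i) → Thm81Conclusion D :=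
  ⟨fun h D ⟨i, hi⟩ => h.2 i D hi, fun h => ⟨hT, fun i D hi => h D ⟨i, hi⟩⟩⟩

end FaceInstance

/-! ## 12. Explicit Picard forms `T = δ · diag(1, 1, a)` -/

section PicardForm

variable (K : Type*) [Field K] [NumberField K] [IsCMField K]

/-- The skew-hermitian form `T = δ · diag(1, 1, a)` on `K^3` (`δ` purely imaginary, `a ∈ K⁺`). -/
def picardForm (δ a : K) : Matrix (Fin 3) (Fin 3) K :=
  hermitianToSkew K δ (diagonal ![1, 1, a])

/-- `diag(1, 1, a)` is hermitian when `a` is real (`a^ρ = a`). -/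
theorem isHermitian_diag11a {a : K} (ha : star a = a) : (diagonal ![1, 1, a]).IsHermitian := by
  apply isHermitian_diagonal_of_self_adjoint
  funext i
  fin_cases i <;> simp [ha]

/-- `picardForm δ a` is skew-hermitian. -/
theorem isSkewHermitian_picardForm {δ a : K} (hδ : star δ = -δ) (ha : star a = a) :
    IsSkewHermitian K (picardForm K δ a) :=
  isSkewHermitian_hermitianToSkew K hδ (isHermitian_diag11a K ha)

omit [NumberField K] [IsCMField K] in
/-- `diag(1,1,a)^τ = diag(1, 1, τ(a))`. -/
theorem map_diag11a (a : K) (τ : K →+* ℂ) : (diagonal ![1, 1, a]).map τ = diagonal ![1, 1, τ a] := by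
  rw [diagonal_map (map_zero τ)]
  congr 1
  funext i
  fin_cases i <;> simp

/-- The real diagonal matrix `diag(q_i)` with `q_i ≠ 0` as an element of `GL_m(ℂ)`. -/
noncomputable def realDiagonalGL {m : ℕ} (q : Fin m → ℝ) (hq : ∀ i, q i ≠ 0) : GL (Fin m) ℂ :=
  Matrix.GeneralLinearGroup.mkOfDetNeZero (diagonal fun i => ((q i : ℝ) : ℂ))
    (by rw [det_diagonal]; exact Finset.prod_ne_zero_iff.2 fun i _ => Complex.ofReal_ne_zero.2 (hq i))

/-- The matrix of `realDiagonalGL q hq`. -/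
theorem coe_realDiagonalGL {m : ℕ} (q : Fin m → ℝ) (hq : ∀ i, q i ≠ 0) :
    ((realDiagonalGL q hq : GL (Fin m) ℂ) : Matrix (Fin m) (Fin m) ℂ) = diagonal fun i => ((q i : ℝ) : ℂ) :=
  rfl

/-- A real diagonal matrix `diag(q_i)` with `q_i ≠ 0` is a signature frame for `diag(q_i² · (±1))`. -/
theorem isSignatureFrameOf_diagonal_real {m : ℕ} (q : Fin m → ℝ) (hq : ∀ i, q i ≠ 0) (r : ℕ) :
    IsSignatureFrameOf (diagonal fun i => ((q i ^ 2 : ℝ) : ℂ) * (if (i : ℕ) < r then 1 else -1)) r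
      (realDiagonalGL q hq) := by
  unfold IsSignatureFrameOf Jrs
  rw [coe_realDiagonalGL, diagonal_map (map_zero _), diagonal_transpose, diagonal_mul_diagonal,
    diagonal_mul_diagonal]
  congr 1
  funext i
  simp only [Complex.conj_ofReal]
  push_cast
  ring

/-- The Picard datum attached to `δ` (purely imaginary, `≠ 0`), a distinguished `τ₁ ∈ Φ_δ`, and a real `a` with
`τ₁(a) < 0` and `τ(a) > 0` for the other members `τ` of `Φ_δ`: `T = δ · diag(1,1,a)` has `-i T^{τ₁}` of
signature `(2,1)` and `-i T^{τ} > 0` for `τ ∈ Φ_δ \ {τ₁}`; any full lattice `𝔪` completes it to a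
[Sh79] Theorem 8.1 datum with `m = 3`. -/
noncomputable def Thm81Data.ofSignElement (δ a : K) (hδ : star δ = -δ) (h0 : δ ≠ 0) (ha : star a = a)
    (τ₁ : K →+* ℂ) (hτ₁ : τ₁ ∈ cmTypeOfImaginary K δ) (hneg : (τ₁ a).re < 0)
    (hpos : ∀ τ ∈ cmTypeOfImaginary K δ, τ ≠ τ₁ → 0 < (τ a).re)
    (𝔪 : Submodule ℤ (Fin 3 → K)) (h𝔪 : IsFullLattice K 𝔪) : Thm81Data K 2 where
  T := picardForm K δ a
  skew := isSkewHermitian_picardForm K hδ ha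
  Φ := cmTypeOfImaginary K δ
  cmtype := isCMType_cmTypeOfImaginary K hδ h0
  τ := τ₁
  τ_mem := hτ₁
  Q := realDiagonalGL
    ![Real.sqrt (-Complex.I * τ₁ δ).re, Real.sqrt (-Complex.I * τ₁ δ).re,
      Real.sqrt (-((-Complex.I * τ₁ δ).re * (τ₁ a).re))]
    (by
      have hc : 0 < (-Complex.I * τ₁ δ).re := hτ₁
      intro i
      fin_cases i
      · exact (Real.sqrt_pos.2 hc).ne'
      · exact (Real.sqrt_pos.2 hc).ne'
      · exact (Real.sqrt_pos.2 (by nlinarith)).ne')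
  frame := by
    have hc : 0 < (-Complex.I * τ₁ δ).re := hτ₁
    have hcim : (-Complex.I * τ₁ δ).im = 0 := negI_mul_im_eq_zero K hδ τ₁
    have haim : (τ₁ a).im = 0 := by
      have := NumberField.IsCMField.complexEmbedding_complexConj K τ₁ a
      rw [show NumberField.IsCMField.complexConj K a = star a from rfl, ha] at this
      have := congrArg Complex.im this
      simp only [Complex.conj_im] at this
      linarith
    have hnn : 0 ≤ -((-Complex.I * τ₁ δ).re * (τ₁ a).re) := by nlinarith
    have hδre : (τ₁ δ).re = 0 := re_eq_zero_of_star_eq_neg K hδ τ₁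
    have e1 : (-Complex.I * τ₁ δ) = (((-Complex.I * τ₁ δ).re : ℝ) : ℂ) := by
      refine Complex.ext ?_ ?_
      · simp
      · rw [Complex.ofReal_im, hcim]
    have hq : ∀ i, ![Real.sqrt (-Complex.I * τ₁ δ).re, Real.sqrt (-Complex.I * τ₁ δ).re,
        Real.sqrt (-((-Complex.I * τ₁ δ).re * (τ₁ a).re))] i ≠ 0 := by
      intro i
      fin_cases i
      · exact (Real.sqrt_pos.2 hc).ne'
      · exact (Real.sqrt_pos.2 hc).ne'
      · exact (Real.sqrt_pos.2 (by nlinarith)).ne'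
    rw [isSignatureFrame_iff, picardForm, negI_smul_map_hermitianToSkew, map_diag11a]
    convert isSignatureFrameOf_diagonal_real
      ![Real.sqrt (-Complex.I * τ₁ δ).re, Real.sqrt (-Complex.I * τ₁ δ).re,
        Real.sqrt (-((-Complex.I * τ₁ δ).re * (τ₁ a).re))] hq 2 using 2
    rw [smul_eq_diagonal_mul, diagonal_mul_diagonal]
    congr 1
    funext i
    fin_cases i
    · simp only [Fin.zero_eta, Fin.isValue, Matrix.cons_val_zero, mul_one, Nat.zero_lt_succ, if_true]
      rw [Real.sq_sqrt hc.le]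
      exact e1
    · simp only [Fin.mk_one, Fin.isValue, Matrix.cons_val_one, Matrix.cons_val_zero, mul_one,
        Nat.one_lt_succ_succ, if_true]
      rw [Real.sq_sqrt hc.le]
      exact e1
    · simp only [Fin.reduceFinMk, Matrix.cons_val_two, Matrix.tail_cons, Matrix.head_cons,
        lt_self_iff_false, if_false, mul_neg, mul_one]
      rw [Real.sq_sqrt hnn]
      apply Complex.ext
      · simp [Complex.mul_re, hδre]
      · simp [Complex.mul_im, hδre, haim]
  definite := by
    intro τ hτ hne
    rw [picardForm, negI_smul_map_hermitianToSkew, map_diag11a]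
    have hτa : 0 < τ a := by
      have him : (τ a).im = 0 := by
        have := NumberField.IsCMField.complexEmbedding_complexConj K τ a
        rw [show NumberField.IsCMField.complexConj K a = star a from rfl, ha] at this
        have := congrArg Complex.im this
        simp only [Complex.conj_im] at this
        linarith
      rw [Complex.lt_def]
      exact ⟨by simpa using hpos τ hτ hne, by simpa using him.symm⟩
    refine Matrix.PosDef.smul ?_ ((zero_lt_negI_mul_iff K hδ τ).2 hτ)
    apply Matrix.PosDef.diagonal
    intro i
    fin_cases i
    · exact zero_lt_one
    · exact zero_lt_one
    · exact hτa
  𝔪 := 𝔪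
  lattice := h𝔪

end PicardForm

/-! ## 13. Reflex field; the irregularity bound from Theorem 8.1 -/

section ReflexAndIrregularity

variable {K : Type*} [Field K] [NumberField K] [IsCMField K]

/-- The reflex field of a Theorem 8.1 datum: the subfield `τ_1(K) ⊂ ℂ`.  For the generalised CM type
`Φ = (m-1) τ_1 + τ_1 ρ + m (τ_2 + ⋯ + τ_g)` of [Sh79] §4 (display on p. 573) the field of definition of the
Hodge cocharacter is the field fixed by the automorphisms of `ℂ` preserving `Φ`, i.e. `τ_1(K)`; [DR15] p. 4:
`Y_Γ` "can be defined over a finite abelian extension of the reflex field `M`".  The conjugate datum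
(`Thm81Data.conj`) has the complex-conjugate reflex field. -/
noncomputable def Thm81Data.reflexField {r : ℕ} (D : Thm81Data K r) : Subfield ℂ := D.τ.fieldRange

/-- Theorem 8.1's conclusion for `D` yields a finite-index `Γ' ≤ Γ_1` and `r` linearly independent
`Γ'`-invariant closed holomorphic 1-forms on `D_r` (elements of `invariantFormSpace`). -/
theorem exists_linearIndependent_of_thm81Conclusion {r : ℕ} (D : Thm81Data K r) (h : Thm81Conclusion D) :
    ∃ Γ' : Subgroup (GL (Fin (r + 1)) K), Γ' ≤ D.Gamma1 ∧ Γ'.relIndex D.Gamma1 ≠ 0 ∧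
      ∃ ξ : Fin r → invariantFormSpace r
        ((fun γ : GL (Fin (r + 1)) K => embedAt K D.τ D.Q (γ : Matrix (Fin (r + 1)) (Fin (r + 1)) K)) '' Γ'),
        LinearIndependent ℂ ξ := by
  obtain ⟨Γ', hle, hidx, ξ, hinv, hwedge⟩ := h
  refine ⟨Γ', hle, hidx, fun k => ⟨(ξ k).coeff, mem_invariantFormSpace_of_thm81 D Γ' ξ hinv k⟩, ?_⟩
  exact LinearIndependent.of_comp (invariantFormSpace r _).subtype
    (linearIndependent_of_wedgeNonzero ξ hwedge)

/-- `r` linearly independent invariant forms give irregularity `≥ r` (when the space is finite-dimensional,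
as it is for a compact quotient). -/
theorem le_irregularity_of_linearIndependent {r : ℕ} {S : Set (Matrix (Fin (r + 1)) (Fin (r + 1)) ℂ)}
    [Module.Finite ℂ (invariantFormSpace r S)] (ξ : Fin r → invariantFormSpace r S)
    (h : LinearIndependent ℂ ξ) : r ≤ irregularity r S := by
  have := h.fintype_card_le_finrank
  simpa [irregularity] using this

end ReflexAndIrregularity

end Summit.Ventures.HodgeRepro2
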